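import Literature.AlgebraicGeometry.Motives.AbelianVarietyConjugateTransport
import Literature.AlgebraicGeometry.Motives.AbelianVarietyFrobeniusTwistTateModule
import Literature.AlgebraicGeometry.Motives.AbelianVarietyGoodReductionTorsion
import Literature.NumberTheory.GaloisRepresentations.AbsGaloisConjByPrime
import HarnessLib

/-!
# The `ℓ`-adic specialisation datum of the Frobenius conjugate `(A^γ)~ = Ã^{(q)}`, TRANSPORTED along `σ̃` and `π`
# — [Shimura 1998, §18.6 proof of Thm. 18.6, p. 129 «`(Y^σ)~ = Ỹ^f` … `(t^σ)~ = π(t̃)`»; §11.1 Prop. 14 (i); §19.4 (19.4a)]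

Topic `Literature/AlgebraicGeometry/Motives`; namespace `Literature.AlgebraicGeometry.Motives.AbelianVariety`, grouping
sub-namespace `GoodReductionAt.TateSpecialisation`.  Definitions + theorems, NO named fact, no instance, no notation (net
Literature debt 0).  Cell `hodgecm-mathlib` (D-0151), row II-1, edition E4 (`S5c′`), pieces **Q3/Q4** of the map of record
(B-p09 `READFIRST-E4-S5c-prime.md` §2; E4 ruling B-p20 2026-08-28T08:27:54Z (3); harness `ConjFrob-harness.lean` 5072909d,
whose three ASSEMBLY targets this file proves VERBATIM over the landed leaves L1 `AbelianVarietyConjugateTransport` (A-p04),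
L2 `AbelianVarietyFrobeniusTwistTateModule` (B-p12), L3 `AbsGaloisConjBy`/`AbsGaloisConjByPrime` (B-p09/A-p16)).

WHAT IS HERE.  Fix a number field `K ⊇ F₀`, an abelian variety `A₀ / K` with a good-reduction datum `R` at `v` and an
`ℓ`-adic specialisation datum `T : R.TateSpecialisation ℓ` (prime `𝔓 = T.prime ∣ v`, `T.equiv : T_ℓ A₀ ≃ T_ℓ Ã`), an
arithmetic Frobenius `γ ∈ Aut(K/F₀)` at `v` with `q = #(𝓞 F₀ / v ∩ 𝓞 F₀) = pⁿ`, and `σ̃ : K̄ ≃+* K̄` over `γ` which is a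
Frobenius AT `𝔓` (`hσ𝔓 : σ̃ x ≡ x^q (mod 𝔓)` on `ℤ̄_K` — supplied by `exists_algEquiv_algebraicClosure_lift_of_isArithFrobAt`
at `T.prime_mem`).  The Frobenius-conjugate datum `R.conjFrob γ hγ p n hq` of `A₀^γ` has reduction `Ã^{(q)}` ON THE NOSE
(`conjFrob_reduction`, `rfl`).  Then:
* `relFrobeniusTateEquiv p n A ℓ : T_ℓ A ≃ₗ T_ℓ A^{(pⁿ)}` — `T_ℓ(π)` as an isomorphism (`π` the relative `pⁿ`-Frobenius,
  bijective on `k̄`-points; B-p12's `exists_tateModuleEquiv_relFrobenius`, named);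
* `TateSpecialisation.conjFrobEquiv T γ hγ p n hq σ̃ hσa : T_ℓ A₀^γ ≃ₗ T_ℓ Ã^{(q)}` := `T_ℓ(σ̃-tr)⁻¹ ≫ T.equiv ≫ T_ℓ(π)`,
  `σ̃-tr = conjTransportTateEquiv` (A-p04: `x ↦ x^σ̃` on `T_ℓ`);
* ★ `TateSpecialisation.conjFrob T γ hγ p n hq σ̃ hσa hσ𝔓 : (R.conjFrob γ hγ p n hq).TateSpecialisation ℓ` — the
  TRANSPORTED datum: same prime `𝔓`; inertia `I_𝔓` acts trivially on `T_ℓ A₀^γ` because `σ̃⁻¹ I_𝔓 σ̃ = I_𝔓`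
  (`absGalConjBy_mem_inertia`) and `τ • x^σ̃ = ((σ̃⁻¹τσ̃) • x)^σ̃` (`conjTransportTateEquiv_smul_of_semiconj`); a Frobenius
  `τ` at `𝔓` specialises to `T_ℓ(Frob_{Ã^{(q)}})` because `σ̃⁻¹τσ̃` is again a Frobenius at `𝔓` (`isArithFrobAt_absGalConjBy`),
  (19.4a) for `T`, and `π` intertwines the Frobenius endomorphisms (`tateModuleMap_relFrobenius_tateModuleMap_frobeniusHom`);
  `T_ℓ(β^γ)` specialises to `T_ℓ((β^γ)~) = T_ℓ(β̃^{(q)})` (`conjEndEquiv` surjective, `conjTransportTateEquiv_tateModuleMap`,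
  `T.equiv_tateModuleMap`, `redEnd_conjFrob`, `tateModuleMap_relFrobenius_tateModuleMap_end`);
* `conjFrob_prime` (`rfl`: ONE common prime, [Shimura §11.1 Prop. 14 (i)]), `conjFrob_equiv(_apply)`,
  `conjFrob_equiv_conjTransportTateEquiv`, `proj_conjFrob_equiv` («`(Tγ.equiv a^σ̃)_m = π((T.equiv a)_m)`», the shape
  the produced-currency consumers read), and ★ `conjFrob_reductionTorsionEquiv` = the GEOMETRIC torsion clause (2′)
  «`(t^σ̃)~ = π(t̃)`» of `GoodReductionAt.HomReduction.exists_isTateCompatible_family_conjFrob` VERBATIM.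
No model geometry is used: this is pure transport over an ABSTRACT `R` (the one geometric input of `S5c′`, the Tate
compatibility of the companions `Hγ`, is the separate piece Q5).

HC_CM is proved only modulo the 7 printed citations until rung 0 closes.

## References
* [Shimura1998] G. Shimura, *Abelian Varieties with Complex Multiplication and Modular Functions*, Princeton 1998, §11.1
  Prop. 14 (i) (pp. 83–87), §18.6 proof of Thm. 18.6 (pp. 128–130: «`(Y^σ)~ = Ỹ^f` for every object `Y` rational over `L`
  … `(t^σ)~ = π(t̃)`»), §19.4 (19.4a), Lemma 19.5.
* [SerreTate1968] J.-P. Serre, J. Tate, *Good reduction of abelian varieties*, Ann. of Math. 88 (1968), §1 Thm. 1.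
* [NeukirchANT1999] J. Neukirch, *Algebraic Number Theory* (1999), Ch. I §9 (decomposition and inertia groups).
-/

set_option autoImplicit false

noncomputable section

open CategoryTheory AlgebraicGeometry IsDedekindDomain IsDedekindDomain.HeightOneSpectrum
open scoped NumberField
open Literature.NumberTheory.EllipticCurves Literature.NumberTheory.GaloisRepresentations

namespace Literature.AlgebraicGeometry.Motives

namespace AbelianVariety

/-! ### `T_ℓ(π)` as an isomorphism, NAMED -/

section FrobEquiv

universe u

variable {k : Type u} [Field k] (p : ℕ) [ExpChar k p] (n : ℕ) (A : AbelianVariety k) (ℓ : ℕ) [Fact ℓ.Prime]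

/-- **`T_ℓ(π) : T_ℓ A ≃ T_ℓ A^{(pⁿ)}`** — `T_ℓ` of the relative Frobenius `π = F^{(n)}_{A/k}` as a `ℤ_ℓ`-linear
ISOMORPHISM (`π` is bijective on `k̄`-points; a choice from `exists_tateModuleEquiv_relFrobenius`, pinned by
`relFrobeniusTateEquiv_apply`). [cite: Shimura1998, §18.6 proof of Thm. 18.6, p. 129] -/
def relFrobeniusTateEquiv : A.tateModule ℓ ≃ₗ[ℤ_[ℓ]] (A.frobeniusTwist p n).tateModule ℓ :=
  (A.exists_tateModuleEquiv_relFrobenius p n ℓ).choose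

/-- `T_ℓ(π)` IS `tateModuleMap ℓ π`. [cite: Shimura1998, §18.6 proof of Thm. 18.6, p. 129] -/
@[simp] theorem relFrobeniusTateEquiv_apply (a : A.tateModule ℓ) :
    relFrobeniusTateEquiv p n A ℓ a = tateModuleMap ℓ (A.relFrobenius p n) a :=
  congrFun (A.exists_tateModuleEquiv_relFrobenius p n ℓ).choose_spec a

end FrobEquiv

/-! ### The transported specialisation datum of the Frobenius conjugate -/

namespace GoodReductionAt

namespace TateSpecialisation

variable {F₀ K : Type} [Field F₀] [Field K] [NumberField K] [Algebra F₀ K]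
  {A₀ : AbelianVariety K} {v : HeightOneSpectrum (𝓞 K)} {R : A₀.GoodReductionAt v} {ℓ : ℕ} [Fact ℓ.Prime]
  (T : R.TateSpecialisation ℓ) (γ : K ≃ₐ[F₀] K) (hγ : IsArithFrobAt (𝓞 F₀) γ v.asIdeal)
  (p n : ℕ) [ExpChar v.asIdeal.ResidueField p] (hq : Nat.card (𝓞 F₀ ⧸ v.asIdeal.under (𝓞 F₀)) = p ^ n)
  (σt : AlgebraicClosure K ≃+* AlgebraicClosure K)
  (hσa : ∀ a : K, σt (algebraMap K (AlgebraicClosure K) a) = algebraMap K (AlgebraicClosure K) (γ.toRingEquiv a))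
  (hσ𝔓 : ∀ x : absIntegers (𝓞 K) K, ∃ hx : σt x ∈ absIntegers (𝓞 K) K,
    (⟨σt x, hx⟩ : absIntegers (𝓞 K) K) - x ^ Nat.card (𝓞 F₀ ⧸ v.asIdeal.under (𝓞 F₀)) ∈ T.prime)

include hq in
omit [NumberField K] in
/-- `1 ≤ q` for `q = pⁿ`, `p` an exponential characteristic (the hypothesis `hq : 1 ≤ q` of `AbsGaloisConjByPrime`). [folklore] -/
private theorem one_le_card_quot : 1 ≤ Nat.card (𝓞 F₀ ⧸ v.asIdeal.under (𝓞 F₀)) := by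
  rw [hq]; exact Nat.one_le_pow n p (expChar_pos v.asIdeal.ResidueField p)

/-! #### The reduction isomorphism of the transported datum, NAMED at the conjugate's types -/

/-- **`T_ℓ A₀^γ ≃ T_ℓ (A₀^γ)~ = T_ℓ Ã^{(q)}`, the reduction isomorphism of the TRANSPORTED datum**:
`T_ℓ(σ̃-tr)⁻¹ ≫ T.equiv ≫ T_ℓ(π)` (`(A₀^γ)~ = Ã^{(q)}` by `rfl`, `conjFrob_reduction`).
[cite: Shimura1998, §18.6 proof of Thm. 18.6, p. 129] -/
def conjFrobEquiv :
    (A₀.conjugate γ.toRingEquiv).tateModule ℓ ≃ₗ[ℤ_[ℓ]] (R.conjFrob γ hγ p n hq).reduction.tateModule ℓ :=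
  (conjTransportTateEquiv γ.toRingEquiv σt hσa A₀ ℓ).symm ≪≫ₗ T.equiv ≪≫ₗ relFrobeniusTateEquiv p n R.reduction ℓ

/-- `conjFrobEquiv x = T_ℓ(π) (T.equiv (T_ℓ(σ̃-tr)⁻¹ x))`. [cite: Shimura1998, §18.6 proof of Thm. 18.6, p. 129] -/
theorem conjFrobEquiv_apply (x : (A₀.conjugate γ.toRingEquiv).tateModule ℓ) :
    conjFrobEquiv T γ hγ p n hq σt hσa x =
      tateModuleMap ℓ (R.reduction.relFrobenius p n)
        (T.equiv ((conjTransportTateEquiv γ.toRingEquiv σt hσa A₀ ℓ).symm x)) := by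
  change relFrobeniusTateEquiv p n R.reduction ℓ (T.equiv ((conjTransportTateEquiv γ.toRingEquiv σt hσa A₀ ℓ).symm x)) = _
  rw [relFrobeniusTateEquiv_apply]

/-- On transported elements: `conjFrobEquiv (T_ℓ(σ̃-tr) a) = T_ℓ(π) (T.equiv a)`. [cite: Shimura1998, §18.6 proof of Thm. 18.6, p. 129] -/
theorem conjFrobEquiv_conjTransportTateEquiv (a : A₀.tateModule ℓ) :
    conjFrobEquiv T γ hγ p n hq σt hσa (conjTransportTateEquiv γ.toRingEquiv σt hσa A₀ ℓ a) =
      tateModuleMap ℓ (R.reduction.relFrobenius p n) (T.equiv a) := by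
  rw [conjFrobEquiv_apply, LinearEquiv.symm_apply_apply]

include hσ𝔓 in
/-- ★ **The `ℓ`-adic specialisation datum of the Frobenius conjugate `(A₀^γ, (R).conjFrob γ hγ p n hq)`
TRANSPORTED from `T`** along `σ̃` (on the generic side, `T_ℓ A₀^γ ≃ T_ℓ A₀` by `x^σ̃ ↤ x`) and the relative
Frobenius `π : Ã → Ã^{(q)}` (on the special side): `equiv := T_ℓ(σ̃-tr)⁻¹ ≫ T.equiv ≫ T_ℓ(π)`, same prime `𝔓 = T.prime`.
Inertia acts trivially because `σ̃⁻¹ I_𝔓 σ̃ = I_𝔓` (σ̃ is a Frobenius AT `𝔓`, `hσ𝔓`); a Frobenius `τ` at `𝔓` goes to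
`T_ℓ(Frob_{Ã^{(q)}})` because `σ̃⁻¹τσ̃` is again a Frobenius at `𝔓` and `π` intertwines the Frobenius endomorphisms;
`T_ℓ(β^γ)` goes to `T_ℓ((β̃)^{(q)}) = T_ℓ((β^γ)~)` (`redEnd_conjFrob`).  [Shimura1998] §18.6 p. 129: «`(Y^σ)~ = Ỹ^f` for every
object `Y` rational over `L` … `(t^σ)~ = π(t̃)`». [cite: Shimura1998, §18.6 proof of Thm. 18.6, p. 129; §19.4 (19.4a)] -/
def conjFrob : (R.conjFrob γ hγ p n hq).TateSpecialisation ℓ where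
  prime := T.prime
  prime_mem := T.prime_mem
  equiv := conjFrobEquiv T γ hγ p n hq σt hσa
  smul_eq_self_of_mem_inertia τ hτ x := by
    haveI : T.prime.IsMaximal := isMaximal_of_mem_primesAbove T.prime_mem
    obtain ⟨y, rfl⟩ := (conjTransportTateEquiv γ.toRingEquiv σt hσa A₀ ℓ).surjective x
    rw [← conjTransportTateEquiv_smul_of_semiconj hσa _ τ (apply_absGalConjBy_smul σt γ.toRingEquiv hσa τ),
      T.smul_eq_self_of_mem_inertia _
        (absGalConjBy_mem_inertia σt T.prime _ hσ𝔓 γ.toRingEquiv hσa (one_le_card_quot p n hq) hτ)]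
  equiv_smul τ hτ x := by
    haveI : T.prime.IsMaximal := isMaximal_of_mem_primesAbove T.prime_mem
    obtain ⟨y, rfl⟩ := (conjTransportTateEquiv γ.toRingEquiv σt hσa A₀ ℓ).surjective x
    rw [← conjTransportTateEquiv_smul_of_semiconj hσa _ τ (apply_absGalConjBy_smul σt γ.toRingEquiv hσa τ),
      conjFrobEquiv_conjTransportTateEquiv, conjFrobEquiv_conjTransportTateEquiv,
      T.equiv_smul _ (isArithFrobAt_absGalConjBy σt T.prime _ hσ𝔓 γ.toRingEquiv hσa (one_le_card_quot p n hq) hτ)]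
    exact tateModuleMap_relFrobenius_tateModuleMap_frobeniusHom p n R.reduction ℓ _
  equiv_tateModuleMap f x := by
    obtain ⟨β, rfl⟩ := (A₀.conjEndEquiv γ.toRingEquiv).surjective f
    obtain ⟨y, rfl⟩ := (conjTransportTateEquiv γ.toRingEquiv σt hσa A₀ ℓ).surjective x
    rw [← conjTransportTateEquiv_tateModuleMap hσa, conjFrobEquiv_conjTransportTateEquiv,
      conjFrobEquiv_conjTransportTateEquiv, T.equiv_tateModuleMap, conjEndEquiv_apply, GoodReductionAt.redEnd_conjFrob]
    exact tateModuleMap_relFrobenius_tateModuleMap_end p n R.reduction ℓ (R.redEnd β) _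

/-- The transported datum reduces along the SAME prime `𝔓 = T.prime` («one common `𝔭'` for all the
varieties at hand», [Shimura1998] §11.1 Prop. 14 (i)); by `rfl`. [cite: Shimura1998, §11.1 Prop. 14 (i)] -/
theorem conjFrob_prime : (T.conjFrob γ hγ p n hq σt hσa hσ𝔓).prime = T.prime := rfl

/-- The reduction isomorphism of the transported datum is `conjFrobEquiv` (by `rfl`). [cite: Shimura1998, §18.6 proof of Thm. 18.6, p. 129] -/
theorem conjFrob_equiv : (T.conjFrob γ hγ p n hq σt hσa hσ𝔓).equiv = conjFrobEquiv T γ hγ p n hq σt hσa := rfl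

/-- `Tγ.equiv x = T_ℓ(π) (T.equiv (T_ℓ(σ̃-tr)⁻¹ x))`. [cite: Shimura1998, §18.6 proof of Thm. 18.6, p. 129] -/
theorem conjFrob_equiv_apply (x : (A₀.conjugate γ.toRingEquiv).tateModule ℓ) :
    (T.conjFrob γ hγ p n hq σt hσa hσ𝔓).equiv x =
      tateModuleMap ℓ (R.reduction.relFrobenius p n)
        (T.equiv ((conjTransportTateEquiv γ.toRingEquiv σt hσa A₀ ℓ).symm x)) := by
  rw [conjFrob_equiv, conjFrobEquiv_apply]

/-- On the transport of `a ∈ T_ℓ A₀`: **`Tγ.equiv (T_ℓ(σ̃-tr) a) = T_ℓ(π) (T.equiv a)`**. [cite: Shimura1998, §18.6 proof of Thm. 18.6, p. 129] -/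
theorem conjFrob_equiv_conjTransportTateEquiv (a : A₀.tateModule ℓ) :
    (T.conjFrob γ hγ p n hq σt hσa hσ𝔓).equiv (conjTransportTateEquiv γ.toRingEquiv σt hσa A₀ ℓ a) =
      tateModuleMap ℓ (R.reduction.relFrobenius p n) (T.equiv a) := by
  rw [conjFrob_equiv, conjFrobEquiv_conjTransportTateEquiv]

/-- Componentwise, **`(Tγ.equiv (a^σ̃))_m = π ((T.equiv a)_m)`** — the shape the
produced-currency consumers (Q5: Tate compatibility of the companions `Hγ`) read. [cite: Shimura1998, §18.6 proof of Thm. 18.6, p. 129] -/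
theorem proj_conjFrob_equiv (a : A₀.tateModule ℓ) (m : ℕ) :
    TateModule.proj ℓ m ((T.conjFrob γ hγ p n hq σt hσa hσ𝔓).equiv
        (conjTransportTateEquiv γ.toRingEquiv σt hσa A₀ ℓ a)) =
      Hom.geomPointsMap (R.reduction.relFrobenius p n) (TateModule.proj ℓ m (T.equiv a)) := by
  rw [conjFrob_equiv_conjTransportTateEquiv]
  exact proj_tateModuleMap (R.reduction.relFrobenius p n) (T.equiv a) m

/-- ★ **Clause (2′) «`(t^σ̃)~ = π(t̃)`»** ([Shimura1998] §18.6 p. 129) for the transported datum, in the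
VERBATIM shape of `exists_isTateCompatible_family_conjFrob`: for `x ∈ A₀[ℓᵐ](K̄)` and its `σ̃`-conjugate
`x' ∈ A₀^γ[ℓᵐ](K̄)` (read through `(A^γ) ⊗ K̄ ≅ (A ⊗ K̄)^σ̃`), the reduction of `x'` along `Tγ` is `π` of the
reduction of `x` along `T`. [cite: Shimura1998, §18.6 proof of Thm. 18.6, p. 129] -/
theorem conjFrob_reductionTorsionEquiv (hℓv : (ℓ : 𝓞 K) ∉ v.asIdeal) (m : ℕ) (x : A₀.geomTorsion (ℓ ^ m : ℕ))
    (x' : (A₀.conjugate γ.toRingEquiv).geomTorsion (ℓ ^ m : ℕ))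
    (hx' : Additive.toMul (x' : (A₀.conjugate γ.toRingEquiv).geomPoints) =
      ((A₀.conjugate γ.toRingEquiv).pointsMulEquiv (AlgebraicClosure K)).symm
        (AlgPoints.map (conjugateBaseChangeAlongIso γ.toRingEquiv σt hσa A₀).inv.hom.hom.hom
          ((A₀.baseChange (AlgebraicClosure K)).conjPoints σt
            (A₀.pointsMulEquiv (AlgebraicClosure K) (Additive.toMul (x : A₀.geomPoints)))))) :
    ((T.conjFrob γ hγ p n hq σt hσa hσ𝔓).reductionTorsionEquiv hℓv m x' :
        (R.conjFrob γ hγ p n hq).reduction.geomPoints) =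
      Hom.geomPointsMap (R.reduction.relFrobenius p n) (T.reductionTorsionEquiv hℓv m x : R.reduction.geomPoints) := by
  -- `hx'` says `x' = x^σ̃` (`toMul_conjTransport` is `rfl`)
  have hx'' : (x' : (A₀.conjugate γ.toRingEquiv).geomPoints) = conjTransport γ.toRingEquiv σt hσa A₀ x :=
    Additive.toMul.injective hx'
  -- lift `x` to `a ∈ T_ℓ A₀`; then `a^σ̃` lifts `x'`
  have hℓK : (ℓ : K) ≠ 0 := Nat.cast_ne_zero.mpr (Fact.out : ℓ.Prime).ne_zero
  obtain ⟨a, rfl⟩ := A₀.tateModuleProjTorsion_surjective hℓK m x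
  have ha' : (A₀.conjugate γ.toRingEquiv).tateModuleProjTorsion m
      (conjTransportTateEquiv γ.toRingEquiv σt hσa A₀ ℓ a) = x' :=
    Subtype.ext (by rw [coe_tateModuleProjTorsion, proj_conjTransportTateEquiv, hx'', coe_tateModuleProjTorsion])
  rw [← ha', coe_reductionTorsionEquiv_proj, coe_reductionTorsionEquiv_proj]
  exact proj_conjFrob_equiv T γ hγ p n hq σt hσa hσ𝔓 a m

end TateSpecialisation

end GoodReductionAt

end AbelianVariety

end Literature.AlgebraicGeometry.Motives

end
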